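import Summits.Ventures.PercRepro.RankLevelSetRuleQModelMatroid

/-!
# PercRepro — THE MODEL MATROID: THE `Y`-SETS ABOVE A MEMBER OF THE FLAT (night-1, gen 14; the second step of `ModelRecvEq`)

For `Z ⊆ F` with `#Z = q` (a class-0 member) the `Y`-sets of the cell `(p, q)` containing `Z` are exactly the `S` with
`Z ⊆ S ⊆ E` and `1 ≤ #(S ∖ F) ≤ p − q − 1` — the index sets `Z ∪ X_P ∪ X_D` of dossier §23.8 (A).
* **`modelMatroid_mem_cellY_iff_of_subset`** — that characterisation (from `modelMatroid_eRk`: the rank of such an `S` is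
  `min(q + #(S ∖ F), p)`).
What remains for `ModelRecvEq` (successor): `memCount` of such an `S` is `m̂(q, #F − q; #(S ∩ F) − q, #(S ∖ F))` (count the
`q`-subsets of `S` by their trace on `S ∖ F`, Vandermonde on the rest), there are `C(#F − q, a)·C(#(E ∖ F), j)` such `S` of
type `(a, j)`, and the Rule Q sum regroups by type into `rhat`.  Axioms: standard.
-/

namespace PercRepro

open Set Matroid

variable {α : Type}

/-- **The `Y`-sets above a member of the flat**: for `Z ⊆ F`, `#Z = q`, `q < p`, a set `S ⊇ Z` is in `Y` iff `S ⊆ E` and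
`1 ≤ #(S ∖ F) ≤ p − q − 1`. -/
theorem modelMatroid_mem_cellY_iff_of_subset {E F : Set α} (hE : E.Finite) (hF : F ⊆ E) {q p : ℕ} (hqp : q < p)
    {Z S : Set α} (hZF : Z ⊆ F) (hZq : Z.ncard = q) (hZS : Z ⊆ S) :
    S ∈ cellY (modelMatroid hE F q p) p q ↔ S ⊆ E ∧ 1 ≤ (S \ F).ncard ∧ (S \ F).ncard ≤ p - q - 1 := by
  have hZfin : Z.Finite := hE.subset (hZF.trans hF)
  constructor
  · rintro ⟨hSE, hlo, hhi⟩
    rw [modelMatroid_E] at hSE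
    rw [modelMatroid_eRk hE F hqp.le hSE] at hlo hhi
    have hlo' : q < min (min (S ∩ F).ncard q + (S \ F).ncard) p := by exact_mod_cast hlo
    have hhi' : min (min (S ∩ F).ncard q + (S \ F).ncard) p < p := by exact_mod_cast hhi
    have hZSF : Z ⊆ S ∩ F := subset_inter hZS hZF
    have hq' : q ≤ (S ∩ F).ncard := by
      rw [← hZq]
      exact Set.ncard_le_ncard hZSF ((hE.subset hSE).inter_of_left F)
    refine ⟨hSE, ?_, ?_⟩ <;> omega
  · rintro ⟨hSE, hlo, hhi⟩
    have hZSF : Z ⊆ S ∩ F := subset_inter hZS hZF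
    have hq' : q ≤ (S ∩ F).ncard := by
      rw [← hZq]
      exact Set.ncard_le_ncard hZSF ((hE.subset hSE).inter_of_left F)
    refine ⟨by rw [modelMatroid_E]; exact hSE, ?_, ?_⟩
    · rw [modelMatroid_eRk hE F hqp.le hSE]
      exact_mod_cast (show q < min (min (S ∩ F).ncard q + (S \ F).ncard) p by omega)
    · rw [modelMatroid_eRk hE F hqp.le hSE]
      exact_mod_cast (show min (min (S ∩ F).ncard q + (S \ F).ncard) p < p by omega)

end PercRepro
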